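import Summits.ResolutionOfSingularities.ResolutionOfSingularities.Theorems.FrobeniusLadderFInjectiveMacaulayficationPointCentreIdealSheaf
import Summits.ResolutionOfSingularities.ResolutionOfSingularities.Theorems.FrobeniusLadderFInjectiveMacaulayficationBlowupStalkOverAffine
import Summits.ResolutionOfSingularities.ResolutionOfSingularities.Theorems.FrobeniusLadderFInjectiveMacaulayficationAffineBlowupStalkClause
import Summits.ResolutionOfSingularities.ResolutionOfSingularities.Theorems.FrobeniusLadderFInjectiveMacaulayficationClauseOffCentre
import HarnessLib

/-!
# Crux `FInjectiveMacaulayfication`: a point-centre EXISTS at a bad point as soon as one affine chart carries certified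
charts — the bridge from line `Sketch`'s toolbox to line `isolation`'s local core `stub_pointCentreExists` (cycle 7, seat c6)

Support file for crux `stmt-ResolutionOfSingularities-15315` (`FrobeniusLadder.FInjectiveMacaulayfication`, route
`ResolutionOfSingularities/FrobeniusLadder`, rung 2).

The strategist's ISOLATION SPLIT leaves two research-level holes; the pointwise one, `stub_pointCentreExists`
(`Cruxes/…/Lines/isolation.lean`), asks at an isolated bad closed point `b` of an integral Cohen–Macaulay `X₁` for an ideal
sheaf `J ≠ ⊥` with `supp J = {b}` such that EVERY blow-up of `X₁` along `J` (universal property) satisfies the full stalk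
clause at its points over `b`. This file reduces that SEMANTIC requirement to the CHART CERTIFICATES line `Sketch` computes
(Fedder E2 / Jacobian / deformation E1 / degree-zero descent E4): if `b` lies in an affine open `U` on which it is the only
bad point, `char Γ(X₁, U) = p`, and `I ⊆ Γ(X₁, U)` is a non-zero ideal with zero locus `{b}` whose chart rings
`Γ(U)[I/xᵢ]` satisfy the Cohen–Macaulay + Frobenius-closed clause at their maximal ideals containing `xᵢ/1`, then the
point-centre ideal sheaf `J` of `I` (`PointCentreIdealSheaf`, p148869) is such a centre: any blow-up `π` of `J` has, over the
affine `U`, the stalks of `affineBlowup (J(U)) = affineBlowup I` (`BlowupStalkOverAffine`, p141181), and those satisfy the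
full clause by the affine blow-up glue E6″ (`AffineBlowupStalkClause`, p141223) from the certificates and the clause off
`b` on `U` (`ClauseOffCentre`, p141324).

So `stub_pointCentreExists` at `b` ⇐ "some 𝔪_b-primary-cosupported ideal of some affine chart around `b` has certified
charts" — a statement of commutative algebra about one finitely generated `k`-algebra and one ideal; every landed
calibration (`E8Char5FiModel`, `E7Char3FiModel`, the char-3 tower) is an instance. [folklore]
-/

-- single-problem summit: the doubled namespace component is forced
set_option linter.dupNamespace false

noncomputable section

namespace Summit.ResolutionOfSingularities.ResolutionOfSingularities.Theorems.FInjectiveMacaulayfication.PointCentreOfCertifiedCharts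

open AlgebraicGeometry CategoryTheory Literature.AlgebraicGeometry.Resolution

/-- **A certified chart gives a point-centre in the sense of `stub_pointCentreExists`** (registered helper stub
`stub_pointCentreOfCertifiedCharts` of crux stmt-ResolutionOfSingularities-15315): `X₁` integral and locally Noetherian;
`b` a closed point of an affine open `U` with `char Γ(X₁, U) = p`; `I ≠ 0` an ideal of `Γ(X₁, U)` with zero locus `{b}` in
`U`; the full stalk clause at every point of `U` other than `b`; generators `xᵢ` of `I` whose chart rings satisfy the
Cohen–Macaulay + Frobenius-closed clause at their maximal ideals containing `xᵢ/1`. Then there is an ideal sheaf `J ≠ ⊥`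
with `supp J = {b}` such that every blow-up of `X₁` along `J` satisfies the full clause at all its points over `b` (indeed
at all its points over `U`). [folklore] -/
theorem stub_pointCentreOfCertifiedCharts : ∀ (p : ℕ) [Fact p.Prime] (X₁ : Scheme.{0}) [IsIntegral X₁]
    [IsLocallyNoetherian X₁] (b : X₁), IsClosed ({b} : Set X₁) →
    ∀ (U : X₁.affineOpens), b ∈ (U : X₁.Opens) → CharP Γ(X₁, U) p → ∀ (I : Ideal Γ(X₁, U)), I ≠ ⊥ →
    (∀ (x : X₁) (hx : x ∈ (U : X₁.Opens)), I ≤ (U.2.primeIdealOf ⟨x, hx⟩).asIdeal ↔ x = b) →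
    (∀ x : X₁, x ∈ (U : X₁.Opens) → x ≠ b →
      IsDomain (X₁.presheaf.stalk x) ∧ ∀ d : ℕ, ringKrullDim (X₁.presheaf.stalk x) = d →
        ∀ s : Fin d → X₁.presheaf.stalk x, (Ideal.span (Set.range s)).radical.IsMaximal →
          RingTheory.Sequence.IsWeaklyRegular (X₁.presheaf.stalk x) (List.ofFn s) ∧
          ∀ y : X₁.presheaf.stalk x, (∃ e : ℕ, y ^ p ^ e ∈ Ideal.span
            ((fun z : X₁.presheaf.stalk x => z ^ p ^ e) ''
              (Ideal.span (Set.range s) : Set (X₁.presheaf.stalk x)))) → y ∈ Ideal.span (Set.range s)) →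
    (∃ (r : ℕ) (x : Fin r → Γ(X₁, U)) (hxI : ∀ i, x i ∈ I), Ideal.span (Set.range x) = I ∧
        ∀ (i : Fin r), x i ≠ 0 →
          ∀ (Q : Ideal (HomogeneousLocalization.Away (reesGrading I) (reesT (x i) (hxI i)))) [Q.IsMaximal],
          reesChartBase (x i) (hxI i) (x i) ∈ Q →
          ∀ d : ℕ, ringKrullDim (Localization.AtPrime Q) = d → ∀ s : Fin d → Localization.AtPrime Q,
            (Ideal.span (Set.range s)).radical.IsMaximal →
              RingTheory.Sequence.IsWeaklyRegular (Localization.AtPrime Q) (List.ofFn s) ∧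
              ∀ y : Localization.AtPrime Q, (∃ e : ℕ, y ^ p ^ e ∈ Ideal.span
                ((fun z : Localization.AtPrime Q => z ^ p ^ e) ''
                  (Ideal.span (Set.range s) : Set (Localization.AtPrime Q)))) → y ∈ Ideal.span (Set.range s)) →
    ∃ J : X₁.IdealSheafData, J ≠ ⊥ ∧ (J.support : Set X₁) = {b} ∧
      ∀ (X' : Scheme.{0}) (π : X' ⟶ X₁), IsBlowup π J →
        ∀ x' : X', π.base x' = b → IsDomain (X'.presheaf.stalk x') ∧
          ∀ d : ℕ, ringKrullDim (X'.presheaf.stalk x') = d → ∀ s : Fin d → X'.presheaf.stalk x',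
            (Ideal.span (Set.range s)).radical.IsMaximal →
            RingTheory.Sequence.IsWeaklyRegular (X'.presheaf.stalk x') (List.ofFn s) ∧
            ∀ y : X'.presheaf.stalk x', (∃ e : ℕ, y ^ p ^ e ∈ Ideal.span
              ((fun z : X'.presheaf.stalk x' => z ^ p ^ e) ''
                (Ideal.span (Set.range s) : Set (X'.presheaf.stalk x')))) → y ∈ Ideal.span (Set.range s) := by
  intro p _ X₁ _ _ b hb U hbU hchar I hI0 hzero hoffU hon
  -- the point-centre ideal sheaf of `I`
  obtain ⟨J, hJU, hsupp, -⟩ := PointCentreIdealSheaf.stub_pointCentreIdealSheaf X₁ U I b hbU hb hzero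
  subst hJU
  refine ⟨J, fun hbot => hI0 (by rw [hbot]; rfl), hsupp, fun X' π hπ x' hx' => ?_⟩
  -- `Γ(X₁, U)` is a Noetherian domain of characteristic `p`
  haveI : Nonempty (U : X₁.Opens) := ⟨⟨b, hbU⟩⟩
  haveI : IsDomain Γ(X₁, U) := IsIntegral.component_integral (U : X₁.Opens)
  haveI : IsNoetherianRing Γ(X₁, U) := IsLocallyNoetherian.component_noetherian U
  haveI : CharP Γ(X₁, U) p := hchar
  -- the stalk of `X'` at `x'` is a stalk of `affineBlowup (J(U))`
  obtain ⟨y, ⟨e⟩⟩ := BlowupStalkOverAffine.stub_blowupStalkOverAffine X₁ X' J π hπ U x' (hx' ▸ hbU)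
  -- every stalk of `affineBlowup (J(U))` satisfies the full clause (E6″), from the clause off `b` on `U` and the charts
  obtain ⟨r, x, hxI, hspan, hcharts⟩ := hon
  have hoff' := ClauseOffCentre.stub_clauseOffCentre p X₁ J U fun z hzU hz => hoffU z hzU (by
    intro hzb
    apply hz
    rw [hsupp, hzb]
    exact Set.mem_singleton b)
  have hall := AffineBlowupStalkClause.stub_affineBlowupStalkClause p Γ(X₁, U) (J.ideal U) r x hxI hspan hI0
    (fun P _ hP => hoff' P hP) hcharts y
  exact fiClause_of_ringEquiv p e.symm hall

end Summit.ResolutionOfSingularities.ResolutionOfSingularities.Theorems.FInjectiveMacaulayfication.PointCentreOfCertifiedCharts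

end
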